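/-
Copyright (c) 2026 the pub-hodgecm-mathlib formalisation cell (harness21).  Prover seat hodgecm-mathlib-LH4-p08 (g2), req620 Track A «(D-RAM) FOUR-FRAME» squad, unit U3_Laws (iii),
MS ROAD STAGE B (Stage B lead LH4-p10 (g2), MS ledger LH4-p11 (g0); dealer LH4-plan (g11)): brick B5 (iv) «GLUED PARAMETER BOX COUNT» of `SPEC-StageB.v2-B5split.LH4p10g2.md`
(a6778cd80cb70dec), sub-brick (iv-b-mem) «GLUED STABILISER MEMBERSHIP» (route LH4-p08 (g2) 2026-09-03T23:56Z: orbit–stabiliser over the FULL unit torus).  2026-09-04.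
-/
import Summits.HodgeConjecture.HodgeConjecture.Theorems.F0P3cDyRamDiagonalHNFStability   -- ★ p855216 (LH4-p10 (g0)): `mapGL_latt_hnf_eq_iff` (the three congruences for `diag(s)·latt V = latt V`)
import Summits.HodgeConjecture.HodgeConjecture.Theorems.F0P3cDyRamDiagonalTorusDefs       -- ★ (LH4-p11 (g0)): `latticeStabilizer`, `unitTorus`, `diagGLUnits`
import HarnessLib

/-!
# Crux `H413`, line LH4 «(D-RAM) FOUR-FRAME» road — unit U3_Laws (iii), MS ROAD STAGE B, brick B5 (iv), sub-brick (iv-b-mem): the UNIT DIAGONAL STABILISER of a GLUED lattice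
# `latt V`, `V = [[1,0,0],[x,ϖ^ρ,0],[xζ+y″, ϖ^ρ ζ, ϖ^{2ρ+2t}]]` (`x, ζ` units, `|y″| = |ϖ|^{2t}`) — membership in coordinates

Cell `hodgecm-mathlib` (D-0151), FLOOR 0, crux item H413 = `stmt-HodgeConjecture-24833`, route of record `HCCMUnconditional`; squad F0∕P3c∕LH4 (req620).  THEOREMS ONLY (no `def`,
no instance, no notation, no `sorry`, default heartbeats); lane `--supports stmt-HodgeConjecture-24833 --as helper` (count-neutral).  First sub-brick of B5 (iv) «GLUED PARAMETER BOX
COUNT» (LH4-p10 (g2) SPEC v2-B5split §B5(iv), dealt 2026-09-03T23:43:59Z) on the ORBIT–STABILISER route: the dualisable part of the glued stratum `G₁(2ρ, 2t)` is a disjoint union of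
unit-torus orbits (one per `F`-rational class of the invariant `κ = y″∕(xζ)` mod `𝔭^{ρ+2t}`), each of size `[𝒯 : Stab_𝒯(latt V)]` (★ (O1) `ncard_unitTorus_orbit_eq_relIndex`); this
file computes the STABILISER in coordinates — the same three congruences serve B5 (iii) (the `σ`-fixed stabiliser) after intersecting with `fixedUnitTorus`.

WHAT IS PROVED (generic valued field `K`, `Valued K ℤᵐ⁰`; `ϖ ≠ 0`; `ρ t : ℕ`; `x, ζ` units, `|y″| = |ϖ|^{2t}`; `u ∈ unitTorus K 3`):
* §1 three valuation rewrites (`v_mul_mul_inv_pow_le_one_iff` & co.: `|a·x·(ϖ^b)⁻¹| ≤ 1 ↔ |a| ≤ |ϖ|^b` for a unit `x`, etc.).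
* §2 **`mem_latticeStabilizer_latt_glued_iff`** — `u ∈ latticeStabilizer (latt V) ↔ (a) |u₁ − u₀| ≤ |ϖ|^ρ ∧ (b) |u₂ − u₁| ≤ |ϖ|^{ρ+2t} ∧ (c) |xζ(u₂ − u₁) + y″(u₂ − u₀)| ≤ |ϖ|^{2ρ+2t}`
  (★ p855216 `mapGL_latt_hnf_eq_iff` at `s = u`, `b = ρ`, `c = 2ρ + 2t`, `y = xζ + y″`, `z = ϖ^ρ ζ`, the `ϖ`-powers cancelled).
* §3 **`mem_latticeStabilizer_latt_glued_iff'`** — the same with (a) DROPPED: (b) ∧ (c) ⇒ (a) (`|y″(u₂ − u₀)| ≤ max(|ϖ|^{2ρ+2t}, |ϖ|^{ρ+2t}) = |ϖ|^{ρ+2t}`, so `|u₂ − u₀| ≤ |ϖ|^ρ`, then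
  `|u₁ − u₀| ≤ max(|u₁ − u₂|, |u₂ − u₀|)`).
HONEST LABEL.  Count-neutral; nothing printed is asserted; the census laws stay PROVER TARGETS; `HC_CM` is proved only modulo the 7 printed citations (2 remaining named inputs: hLiu418 =
`stmt-HodgeConjecture-24832`, h413 = `stmt-HodgeConjecture-24833`) until rung 0 closes.

## References
* [Kottwitz1986BaseChangeUnits] R. Kottwitz, *Base change for unit elements of Hecke algebras*, Compositio Math. 60 (1986), §1 pp. 240–241 (lattice counts via torus orbits and
  diagonal stabilisers).
* [Serre1980Trees] J.-P. Serre, *Trees*, Springer (1980), Ch. II §1.1 (lattices `g·𝒪^N`, Hermite normal forms).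
-/

set_option autoImplicit false

noncomputable section

namespace Summit.HodgeConjecture.HodgeConjecture.Cruxes.H413.F0P3cDyRamDiagonalGluedStabiliserMembership

open Matrix
open Literature.NumberTheory.Automorphic Literature.NumberTheory.Automorphic.HermitianLattice
open Literature.NumberTheory.Automorphic.UnitaryLatticeTree
open Summit.HodgeConjecture.HodgeConjecture.Cruxes.H413.F0P3cDyRamDiagonalTorusDefs
open Summit.HodgeConjecture.HodgeConjecture.Cruxes.H413.F0P3cDyRamDiagonalHNFStability (mapGL_latt_hnf_eq_iff)
open scoped Valued WithZero Matrix MatrixGroups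

variable {K : Type*} [Field K] [Valued K ℤᵐ⁰]

/-! ## §1 Valuation rewrites -/

/-- `|a · (ϖ^n)⁻¹| ≤ 1 ↔ |a| ≤ |ϖ|^n` (`ϖ ≠ 0`). [cite: Serre1980Trees, II §1.1] -/
theorem v_mul_inv_pow_le_one_iff {ϖ : K} (hϖ : ϖ ≠ 0) (n : ℕ) (a : K) :
    Valued.v (a * (ϖ ^ n)⁻¹) ≤ 1 ↔ Valued.v a ≤ Valued.v ϖ ^ n := by
  have hpn : (0 : ℤᵐ⁰) < Valued.v (ϖ ^ n) := (Valuation.pos_iff _).2 (pow_ne_zero n hϖ)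
  rw [map_mul, map_inv₀, ← div_eq_mul_inv, div_le_one₀ hpn, map_pow]

/-- `|ϖ|^m · c ≤ |ϖ|^(m + n) ↔ c ≤ |ϖ|^n` (`ϖ ≠ 0`). [cite: Serre1980Trees, II §1.1] -/
theorem pow_mul_le_pow_add_iff {ϖ : K} (hϖ : ϖ ≠ 0) (m n : ℕ) (c : ℤᵐ⁰) :
    Valued.v ϖ ^ m * c ≤ Valued.v ϖ ^ (m + n) ↔ c ≤ Valued.v ϖ ^ n := by
  have hpm : (0 : ℤᵐ⁰) < Valued.v ϖ ^ m := pow_pos ((Valuation.pos_iff _).2 hϖ) m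
  rw [pow_add, mul_le_mul_iff_right₀ hpm]

/-! ## §2 Membership in the diagonal stabiliser of a glued lattice -/

/-- **THE UNIT DIAGONAL STABILISER OF A GLUED LATTICE, in coordinates.**  For `V = [[1,0,0],[x,ϖ^ρ,0],[xζ+y″, ϖ^ρ ζ, ϖ^{2ρ+2t}]]` with `x, ζ` units, `|y″| = |ϖ|^{2t}` and a unit
diagonal `u ∈ 𝒯`: `diag(u)·latt V = latt V` iff (a) `|u₁ − u₀| ≤ |ϖ|^ρ`, (b) `|u₂ − u₁| ≤ |ϖ|^{ρ+2t}`, (c) `|xζ·(u₂ − u₁) + y″·(u₂ − u₀)| ≤ |ϖ|^{2ρ+2t}` — ★ p855216's three congruences at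
`b = ρ`, `c = 2ρ + 2t`, `y = xζ + y″`, `z = ϖ^ρ ζ`. [cite: Kottwitz1986BaseChangeUnits, §1 pp. 240–241] [cite: Serre1980Trees, II §1.1] -/
theorem mem_latticeStabilizer_latt_glued_iff {ϖ : K} (hϖ : ϖ ≠ 0) (ρ t : ℕ) {x ζ y'' : K} (hx : Valued.v x = 1) (hζ : Valued.v ζ = 1) (_hy'' : Valued.v y'' = Valued.v ϖ ^ (2 * t))
    (V : GL (Fin 3) K) (hV : (V : Matrix (Fin 3) (Fin 3) K) = !![1, 0, 0; x, ϖ ^ ρ, 0; x * ζ + y'', ϖ ^ ρ * ζ, ϖ ^ (2 * ρ + 2 * t)])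
    (u : Fin 3 → Kˣ) (hu : u ∈ unitTorus K 3) :
    u ∈ latticeStabilizer (latt (V : Matrix (Fin 3) (Fin 3) K)) ↔
      Valued.v ((u 1 : K) - u 0) ≤ Valued.v ϖ ^ ρ ∧ Valued.v ((u 2 : K) - u 1) ≤ Valued.v ϖ ^ (ρ + 2 * t) ∧
        Valued.v (x * ζ * ((u 2 : K) - u 1) + y'' * ((u 2 : K) - u 0)) ≤ Valued.v ϖ ^ (2 * ρ + 2 * t) := by
  rw [mem_unitTorus_iff] at hu
  rw [mem_latticeStabilizer_iff, mapGL_latt_hnf_eq_iff hϖ (fun i => (u i : K)) hu (diagGLUnits u) (coe_diagGLUnits u) V hV]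
  have hpρ : ϖ ^ ρ ≠ 0 := pow_ne_zero ρ hϖ
  -- (a)
  have ha : Valued.v (((u 1 : K) - u 0) * x * (ϖ ^ ρ)⁻¹) ≤ 1 ↔ Valued.v ((u 1 : K) - u 0) ≤ Valued.v ϖ ^ ρ := by
    rw [v_mul_inv_pow_le_one_iff hϖ, map_mul, hx, mul_one]
  -- (b)
  have hb : Valued.v (((u 2 : K) - u 1) * (ϖ ^ ρ * ζ) * (ϖ ^ (2 * ρ + 2 * t))⁻¹) ≤ 1 ↔ Valued.v ((u 2 : K) - u 1) ≤ Valued.v ϖ ^ (ρ + 2 * t) := by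
    rw [v_mul_inv_pow_le_one_iff hϖ, map_mul, map_mul, map_pow, hζ, mul_one, mul_comm, show 2 * ρ + 2 * t = ρ + (ρ + 2 * t) by ring,
      pow_mul_le_pow_add_iff hϖ]
  -- (c)
  have hc : Valued.v ((((u 2 : K) - u 0) * (x * ζ + y'') + ((u 0 : K) - u 1) * x * (ϖ ^ ρ * ζ) * (ϖ ^ ρ)⁻¹) * (ϖ ^ (2 * ρ + 2 * t))⁻¹) ≤ 1 ↔
      Valued.v (x * ζ * ((u 2 : K) - u 1) + y'' * ((u 2 : K) - u 0)) ≤ Valued.v ϖ ^ (2 * ρ + 2 * t) := by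
    rw [v_mul_inv_pow_le_one_iff hϖ]
    have : ((u 2 : K) - u 0) * (x * ζ + y'') + ((u 0 : K) - u 1) * x * (ϖ ^ ρ * ζ) * (ϖ ^ ρ)⁻¹ =
        x * ζ * ((u 2 : K) - u 1) + y'' * ((u 2 : K) - u 0) := by
      field_simp
      ring
    rw [this]
  rw [ha, hb, hc]

/-! ## §3 The reduced form: (a) follows from (b) and (c) -/

/-- **REDUCED MEMBERSHIP**: for `t`, `ρ` arbitrary and the glued `V` as above, `u ∈ latticeStabilizer (latt V) ↔ (b) ∧ (c)` — condition (a) `|u₁ − u₀| ≤ |ϖ|^ρ` is implied: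
from (c) and (b), `|y″·(u₂ − u₀)| ≤ max(|ϖ|^{2ρ+2t}, |xζ|·|ϖ|^{ρ+2t}) ≤ |ϖ|^{ρ+2t} = |y″|·|ϖ|^ρ`, so `|u₂ − u₀| ≤ |ϖ|^ρ`, and `|u₁ − u₀| ≤ max(|u₂ − u₁|, |u₂ − u₀|) ≤ |ϖ|^ρ`.
[cite: Kottwitz1986BaseChangeUnits, §1 pp. 240–241] [cite: Serre1980Trees, II §1.1] -/
theorem mem_latticeStabilizer_latt_glued_iff' {ϖ : K} (hϖ : ϖ ≠ 0) (hϖ1 : Valued.v ϖ ≤ 1) (ρ t : ℕ) {x ζ y'' : K} (hx : Valued.v x = 1) (hζ : Valued.v ζ = 1)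
    (hy'' : Valued.v y'' = Valued.v ϖ ^ (2 * t))
    (V : GL (Fin 3) K) (hV : (V : Matrix (Fin 3) (Fin 3) K) = !![1, 0, 0; x, ϖ ^ ρ, 0; x * ζ + y'', ϖ ^ ρ * ζ, ϖ ^ (2 * ρ + 2 * t)])
    (u : Fin 3 → Kˣ) (hu : u ∈ unitTorus K 3) :
    u ∈ latticeStabilizer (latt (V : Matrix (Fin 3) (Fin 3) K)) ↔
      Valued.v ((u 2 : K) - u 1) ≤ Valued.v ϖ ^ (ρ + 2 * t) ∧
        Valued.v (x * ζ * ((u 2 : K) - u 1) + y'' * ((u 2 : K) - u 0)) ≤ Valued.v ϖ ^ (2 * ρ + 2 * t) := by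
  rw [mem_latticeStabilizer_latt_glued_iff hϖ ρ t hx hζ hy'' V hV u hu]
  constructor
  · rintro ⟨-, hb, hc⟩
    exact ⟨hb, hc⟩
  · rintro ⟨hb, hc⟩
    refine ⟨?_, hb, hc⟩
    have hvϖ : (0 : ℤᵐ⁰) < Valued.v ϖ := (Valuation.pos_iff _).2 hϖ
    -- `|y″ (u₂ − u₀)| ≤ |ϖ|^(ρ + 2t)`
    have h20 : Valued.v (y'' * ((u 2 : K) - u 0)) ≤ Valued.v ϖ ^ (ρ + 2 * t) := by
      have hsplit : y'' * ((u 2 : K) - u 0) = (x * ζ * ((u 2 : K) - u 1) + y'' * ((u 2 : K) - u 0)) - x * ζ * ((u 2 : K) - u 1) := by ring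
      rw [hsplit]
      refine le_trans (Valuation.map_sub _ _ _) (max_le (le_trans hc ?_) ?_)
      · rw [show 2 * ρ + 2 * t = ρ + (ρ + 2 * t) by ring, pow_add]
        exact mul_le_of_le_one_left' (pow_le_one₀ zero_le hϖ1)
      · rw [map_mul, map_mul, hx, hζ, one_mul, one_mul]; exact hb
    -- hence `|u₂ − u₀| ≤ |ϖ|^ρ`
    have h20' : Valued.v ((u 2 : K) - u 0) ≤ Valued.v ϖ ^ ρ := by
      rw [map_mul, hy'', mul_comm, show ρ + 2 * t = 2 * t + ρ by ring] at h20
      rwa [mul_comm, pow_mul_le_pow_add_iff hϖ] at h20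
    -- and `|u₁ − u₀| ≤ max(|u₂ − u₀|, |u₂ − u₁|)`
    have hsplit : (u 1 : K) - u 0 = ((u 2 : K) - u 0) - ((u 2 : K) - u 1) := by ring
    rw [hsplit]
    refine le_trans (Valuation.map_sub _ _ _) (max_le h20' (le_trans hb ?_))
    rw [pow_add]
    exact mul_le_of_le_one_right' (pow_le_one₀ zero_le hϖ1)

end Summit.HodgeConjecture.HodgeConjecture.Cruxes.H413.F0P3cDyRamDiagonalGluedStabiliserMembership

end
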